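import Summits.QuantumFields.YangMills.Theorems.BalabanUVNodesN13Cor3Repr218LeavesAtRecord13CoPH
import Literature.MathematicalPhysics.QuantumFieldTheory.Balaban1983to89.Node00.Record9InhabitedSU1
import Summits.QuantumFields.YangMills.Theorems.BalabanUVNodesN21StepWeightsPositivity

/-!
# BalabanUVNodes ∕ N13 — [III] COR. 3 AT NODE 00's STAGE-13 RECORD: LEAF (L1) «history-wise non-negativity of (2.18)» IS A THEOREM OF THE RECORD whenever the fluctuation
# factor `θ.ζ` is non-negative — in particular at EVERY parameter carrying K0b's residuals of record (`Stage12Params.HasResidualsOfRecord`: `θ.ζ = zeta316OfRecord …`, the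
# (3.16) factor typed as a product of characteristic functions) AND at EVERY parameter with the core provisos `Provisos₁₃CoPH` (rows `zetaUnity`, `zetaAbs` force `ζ ≥ 0`: dag-n21-d's
# `N21StepWeightsPositivity.zetaOfRecord_nonneg`) — so that K1⁷'s (B) conjunct at ITS OWN record `datumOfRecord₁₃CoPH θ h` costs Theorem 1 + THREE leaves (U1, U2, L2)
# (companion of `…N13Cor3Repr218LeavesAtRecord13CoPH` p592785; Track A, DAG node N13 = [B16]; cluster K1 — K1⁷ `StabilityBAtRecordR13SepCoPH` = stmt-QuantumFields-20542, helper; seat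
# `pub-ymgap-dag-n13-w3` g0; 2026-08-28; count-neutral)

HONEST FRAMING.  Count-neutral kernel BOOKKEEPING BY NAME; nothing of Bałaban's is asserted.  adv3's leaf (L1) — «every summand `χ_k(Ω_k) 𝐓_k({Ω_j},{Λ_j}) exp A_k` of (2.18) is `≥ 0`», UNPRINTED in
d = 4 (cell GAPS G-adv3-2 (L1)) — is, AT NODE 00's RECORD, the kernel fact that the record's slots are built from `ρ₀ > 0` by T-steps (transport of `w · χ · slot` with `w ≥ 0` as soon as
`ζ ≥ 0`: def-R∕def-T `tstepOfRecord_nonneg`, `wOfRecord_nonneg`) and R-steps ((0.3) ratios of `toReal`s: `rstepSlot_nonneg`) — def-T∕K0's `Node00.slotsOfRecord_nonneg` — times `χ_k(s) ≥ 0`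
(`chiSeqOfRecord_nonneg`).  The sign hypothesis `0 ≤ θ.ζ` is DISPLAYED (§1), or supplied by K0b's residuals of record (`Stage12Params.zeta_nonneg_of_hasResidualsOfRecord`, §1), or — §3 — by K1⁷'s OWN proviso
`h : θ.Provisos₁₃CoPH` (its rows `zetaUnity` `Σ ζ = 1` and `zetaAbs` `Σ |ζ| ≤ 1` force `ζ ≥ 0` termwise: dag-n21-d's `zetaOfRecord_nonneg`, cited by name); print's
(3.16)–(3.22) factors are typed in the tree as products of characteristic functions (`zeta316OfRecord_nonneg`), which is WHY the sign holds at the record — a statement about the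
tree's typing of (3.16), not about a signed cluster expansion.  (U1), (U2), (L2) stay DISPLAYED; Theorem 1 at the record is a HYPOTHESIS where used; N13 NOT discharged; K0⁷ ∕ K1⁷ NOT
closed; counts unmoved (discharged 5∕27 · Track A 5∕28).  The Yang–Mills mass gap (Clay) is NOT proved by any of this; rung R4 `BalabanLadder.UV` (conditional finite-𝕋⁴ bookkeeping) is
the only thing the K-items close.  ONE finite four-torus programme at fixed `ε = L^{-K}`; nothing continuum ∕ ℝ⁴ ∕ OS.  No `sorry`, `def`, `instance`, `notation`.

WHAT THIS FILE PROVES.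
§1 `slotsOfRecord₁₃_nonneg_of_zeta_nonneg` (every slot `(reprOfRecord₁₃ θ P k).TexpA s V ≥ 0`), ★★ `leafL1_at_record₁₃_of_zeta_nonneg` (every history term `χ_k(s)(V)·slot_k(s)(V) ≥ 0`),
   `densOfRecord₁₃_nonneg_of_zeta_nonneg` (`ρ_k ≥ 0` pointwise), and the `HasResidualsOfRecord` forms ★★ `leafL1_at_record₁₃_of_hasResidualsOfRecord` ∕ `densOfRecord₁₃_nonneg_of_hasResidualsOfRecord`.
§2 THREE-LEAF forms of part 1's headline theorems: ★★ `uvIneq_at_record₁₃CoPH_of_U1_U2_L2_of_zeta_nonneg` (one run ∕ one step), ★★★ `cor3With_datumOfRecord₁₃CoPH_of_U1_U2_L2_of_zeta_nonneg`,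
   ★★★ `endStatementBPrinted_datumOfRecord₁₃CoPH_of_thm1_of_U1_U2_L2_of_hasResidualsOfRecord` (K1⁷'s (B) at a record carrying K0b's residuals = Thm 1 at the record + U1 ∕ U2 ∕ L2),
   ★ `hUV₁₃CoPH_of_U1_U2_L2_of_zeta_nonneg` (n24-c's row binder from three leaves).
§3 AT K1⁷'s OWN PROVISO `h : θ.Provisos₁₃CoPH` (no sign hypothesis left): ★★ `leafL1_at_record₁₃_of_provisos₁₃CoPH`, `densOfRecord₁₃_nonneg_of_provisos₁₃CoPH`,
   ★★★ `cor3With_datumOfRecord₁₃CoPH_of_U1_U2_L2`, ★★★ `endStatementBPrinted_datumOfRecord₁₃CoPH_of_thm1_of_U1_U2_L2` (K1⁷'s (B) at its own record = Thm 1 + U1 ∕ U2 ∕ L2 — leaves (H) and (L1)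
   BOTH discharged), ★ `hUV₁₃CoPH_of_U1_U2_L2`.

Sources: [Balaban1988Convergent] (2.17)–(2.18) p.257, (3.2)–(3.5) p.265, (3.16) p.268, (3.24)–(3.25) p.270, Thm 1 p.262, Cor. 3 (2.50) p.264; [Balaban1989LargeFieldI] (0.3) p.176;
[Balaban1989LargeFieldII] Thm 1 p.355, (0.1) pp.355–356, p.380 (1.73)–(1.75), p.391.
-/

noncomputable section

open MeasureTheory
open scoped BigOperators

namespace Summit.QuantumFields.YangMills.BalabanUVNodes.N13Cor3LeafL1AtRecord13CoPH

open Literature.MathematicalPhysics.QuantumFieldTheory.Balaban1983to89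
open T4Continuum T4DatumAssembly Node00 DagBinding FlowStepRuns
open Summit.QuantumFields.YangMills.Theorems.N21StepWeightsPositivity (zetaOfRecord_nonneg)
open Summit.QuantumFields.YangMills.BalabanUVNodes.N13Cor3Repr218LeavesAtRecord13CoPH (uvIneq_at_record₁₃CoPH_of_repr218Leaves
  cor3With_datumOfRecord₁₃CoPH_of_repr218Leaves endStatementBPrinted_datumOfRecord₁₃CoPH_of_thm1_of_repr218Leaves hUV₁₃CoPH_of_repr218Leaves densOfRecord₁₃_eq_sum)

variable (F : T4Family) (N : ℕ) [NeZero N]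

/-! ## §1. Leaf (L1) at the record from the sign of the fluctuation factor -/

section L1

variable (θ : Stage13HParams F N)

/-- **EVERY SLOT OF THE RECORD IS `≥ 0` when `ζ ≥ 0`**: `(reprOfRecord₁₃ θ P k).TexpA s V = slotsOfRecord … P g k s V ≥ 0` (def-T∕K0's `Node00.slotsOfRecord_nonneg` — `ρ₀ > 0`, T-steps with
`w ≥ 0` (`wOfRecord_nonneg` from `ζ ≥ 0`), R-steps by (0.3) ratios of `toReal`s). [cite: Balaban1988Convergent, (2.18) p.257, (3.24) p.270; Balaban1989LargeFieldI, (0.3) p.176 (bookkeeping)] -/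
theorem slotsOfRecord₁₃_nonneg_of_zeta_nonneg (hζ : ∀ p g k s Pl Ql RS U V', 0 ≤ θ.ζ p g k s Pl Ql RS U V') (P : B12.RunParams) (k : ℕ)
    (s : (reprOfRecord₁₃ F N θ.toStage13Params P k).Adm) (V : GaugeField (F.P P.K) k (SU N)) :
    0 ≤ (reprOfRecord₁₃ F N θ.toStage13Params P k).TexpA s V :=
  slotsOfRecord_nonneg F N θ.ν θ.τ9 (EOfRecord₁₃ F N θ.toStage13Params)
    (fun p g k s' U V' => wOfRecord_nonneg F N θ.ν θ.τ9.M p g k θ.A₁ hζ s' U V') θ.ppSel P (gOfRecord₁₃ F N θ.toStage13Params P) k s V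

/-- **★★ LEAF (L1) AT THE RECORD when `ζ ≥ 0`**: every history term of (2.18) is non-negative, `0 ≤ χ_k(s)(V) · slot_k(s)(V)` (`chiSeqOfRecord_nonneg` × §1) — adv3's `LeafL1` read at
`reprOfRecord₁₃ θ P k`, for EVERY run, step, history and configuration (no interval ∕ `SLaw` guard needed). [cite: Balaban1989LargeFieldII, p.380 (1.73)–(1.75); Balaban1988Convergent, (2.18) p.257 (bookkeeping)] -/
theorem leafL1_at_record₁₃_of_zeta_nonneg (hζ : ∀ p g k s Pl Ql RS U V', 0 ≤ θ.ζ p g k s Pl Ql RS U V') (P : B12.RunParams) (k : ℕ)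
    (s : (reprOfRecord₁₃ F N θ.toStage13Params P k).Adm) (V : GaugeField (F.P P.K) k (SU N)) :
    0 ≤ (reprOfRecord₁₃ F N θ.toStage13Params P k).χ s V * (reprOfRecord₁₃ F N θ.toStage13Params P k).TexpA s V :=
  mul_nonneg (chiSeqOfRecord_nonneg F N θ.ν θ.τ9.M (gOfRecord₁₃ F N θ.toStage13Params P) P.K k s V)
    (slotsOfRecord₁₃_nonneg_of_zeta_nonneg F N θ hζ P k s V)

/-- `ρ_k ≥ 0` pointwise at the record when `ζ ≥ 0` (a finite sum of non-negative history terms). [cite: Balaban1989LargeFieldI, p.176 «We will prove that the densities are positive»; Balaban1988Convergent, (2.18) p.257 (bookkeeping)] -/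
theorem densOfRecord₁₃_nonneg_of_zeta_nonneg (hζ : ∀ p g k s Pl Ql RS U V', 0 ≤ θ.ζ p g k s Pl Ql RS U V') (P : B12.RunParams) (k : ℕ)
    (V : GaugeField (F.P P.K) k (SU N)) : 0 ≤ densOfRecord₁₃ F N θ.toStage13Params P k V := by
  rw [densOfRecord₁₃_eq_sum F N θ P k V]
  exact Finset.sum_nonneg fun s _ => leafL1_at_record₁₃_of_zeta_nonneg F N θ hζ P k s V

/-- **★★ LEAF (L1) AT EVERY RECORD CARRYING K0b's RESIDUALS** (`θ.ζ = zeta316OfRecord …`: K0b's `zeta316OfRecord_nonneg` via `Stage12Params.zeta_nonneg_of_hasResidualsOfRecord`) — in particular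
at the K0⁷ witness families (`hasResidualsOfRecord_theta13OfFamily₂`, …). [cite: Balaban1988Convergent, (3.16) p.268, (2.18) p.257 (bookkeeping)] -/
theorem leafL1_at_record₁₃_of_hasResidualsOfRecord (hres : θ.toStage13Params.HasResidualsOfRecord F N) (P : B12.RunParams) (k : ℕ)
    (s : (reprOfRecord₁₃ F N θ.toStage13Params P k).Adm) (V : GaugeField (F.P P.K) k (SU N)) :
    0 ≤ (reprOfRecord₁₃ F N θ.toStage13Params P k).χ s V * (reprOfRecord₁₃ F N θ.toStage13Params P k).TexpA s V :=
  leafL1_at_record₁₃_of_zeta_nonneg F N θ (Stage12Params.zeta_nonneg_of_hasResidualsOfRecord hres) P k s V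

/-- `ρ_k ≥ 0` at every record carrying K0b's residuals. [cite: Balaban1989LargeFieldI, p.176; Balaban1988Convergent, (2.18) p.257 (bookkeeping)] -/
theorem densOfRecord₁₃_nonneg_of_hasResidualsOfRecord (hres : θ.toStage13Params.HasResidualsOfRecord F N) (P : B12.RunParams) (k : ℕ)
    (V : GaugeField (F.P P.K) k (SU N)) : 0 ≤ densOfRecord₁₃ F N θ.toStage13Params P k V :=
  densOfRecord₁₃_nonneg_of_zeta_nonneg F N θ (Stage12Params.zeta_nonneg_of_hasResidualsOfRecord hres) P k V

end L1

/-! ## §2. The headline theorems of part 1 with THREE leaves (U1, U2, L2) when `ζ ≥ 0` ∕ at a record carrying K0b's residuals -/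

section ThreeLeaves

variable (θ : Stage13HParams F N) (h : θ.Provisos₁₃CoPH F N)

/-- **★★ (0.1) AT THE RECORD, ONE RUN ∕ ONE STEP, FROM (U1), (U2), (L2) when `ζ ≥ 0`** (part 1's `uvIneq_at_record₁₃CoPH_of_repr218Leaves` with (L1) := §1). [cite: Balaban1988Convergent, Cor. 3 (2.50) p.264; Balaban1989LargeFieldII, (0.1) p.356 (bookkeeping)] -/
theorem uvIneq_at_record₁₃CoPH_of_U1_U2_L2_of_zeta_nonneg (hζ : ∀ p g k s Pl Ql RS U V', 0 ≤ θ.ζ p g k s Pl Ql RS U V') (P : B12.RunParams) (k : ℕ)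
    (major : (reprOfRecord₁₃ F N θ.toStage13Params P k).Adm → ℝ) (s₀ : (reprOfRecord₁₃ F N θ.toStage13Params P k).Adm) (Em Ep : ℝ)
    (hU1 : ∀ s V, (reprOfRecord₁₃ F N θ.toStage13Params P k).χ s V * (reprOfRecord₁₃ F N θ.toStage13Params P k).TexpA s V ≤ major s)
    (hU2 : ∑ s, major s ≤ Real.exp (Ep * (Fintype.card (Site (F.P P.K) k) : ℝ)))
    (hL2 : ∀ V, chiβOfRecord₁₃ F N θ.toStage13Params P.K (gOfRecord₁₃ F N θ.toStage13Params P) k V *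
        Real.exp (-(1 / (gOfRecord₁₃ F N θ.toStage13Params P k) ^ 2 * wilsonBGOfRecord F N θ.εbg P k V) - Em * (Fintype.card (Site (F.P P.K) k) : ℝ)) ≤
      (reprOfRecord₁₃ F N θ.toStage13Params P k).χ s₀ V * (reprOfRecord₁₃ F N θ.toStage13Params P k).TexpA s₀ V) :
    ∀ V : GaugeField (F.P P.K) k (SU N), B16.UVIneq ((datumOfRecord₁₃CoPH F N θ h).C P) k V Em Ep :=
  uvIneq_at_record₁₃CoPH_of_repr218Leaves F N θ h P k major s₀ Em Ep hU1 hU2 (leafL1_at_record₁₃_of_zeta_nonneg F N θ hζ P k) hL2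

/-- **★★★ [III] COR. 3 «WITH e±» AT THE RECORD FROM (U1), (U2), (L2) when `ζ ≥ 0`** (part 1's `cor3With_…_of_repr218Leaves` with (L1) := §1).
[cite: Balaban1988Convergent, Thm 1 p.262, Cor. 3 (2.50) p.264 (bookkeeping)] -/
theorem cor3With_datumOfRecord₁₃CoPH_of_U1_U2_L2_of_zeta_nonneg (hζ : ∀ p g k s Pl Ql RS U V', 0 ≤ θ.ζ p g k s Pl Ql RS U V') (γ : ℝ) (em ep : ℝ → ℝ)
    (major : (P : B12.RunParams) → (k : ℕ) → (reprOfRecord₁₃ F N θ.toStage13Params P k).Adm → ℝ)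
    (s₀ : (P : B12.RunParams) → (k : ℕ) → (reprOfRecord₁₃ F N θ.toStage13Params P k).Adm)
    (hS : ∀ P : B12.RunParams, ((datumOfRecord₁₃CoPH F N θ h).C P).flow.InInterval γ P.K → ∀ k, k ≤ P.K → SLaw₁₃CoPH F N θ P k)
    (hU1 : ∀ P : B12.RunParams, ((datumOfRecord₁₃CoPH F N θ h).C P).flow.InInterval γ P.K → ∀ k, k ≤ P.K → SLaw₁₃CoPH F N θ P k →
      ∀ s V, (reprOfRecord₁₃ F N θ.toStage13Params P k).χ s V * (reprOfRecord₁₃ F N θ.toStage13Params P k).TexpA s V ≤ major P k s)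
    (hU2 : ∀ P : B12.RunParams, ((datumOfRecord₁₃CoPH F N θ h).C P).flow.InInterval γ P.K → ∀ k, k ≤ P.K → SLaw₁₃CoPH F N θ P k →
      ∑ s, major P k s ≤ Real.exp (ep (gOfRecord₁₃ F N θ.toStage13Params P k) * (Fintype.card (Site (F.P P.K) k) : ℝ)))
    (hL2 : ∀ P : B12.RunParams, ((datumOfRecord₁₃CoPH F N θ h).C P).flow.InInterval γ P.K → ∀ k, k ≤ P.K → SLaw₁₃CoPH F N θ P k →
      ∀ V, chiβOfRecord₁₃ F N θ.toStage13Params P.K (gOfRecord₁₃ F N θ.toStage13Params P) k V *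
          Real.exp (-(1 / (gOfRecord₁₃ F N θ.toStage13Params P k) ^ 2 * wilsonBGOfRecord F N θ.εbg P k V)
            - em (gOfRecord₁₃ F N θ.toStage13Params P k) * (Fintype.card (Site (F.P P.K) k) : ℝ)) ≤
        (reprOfRecord₁₃ F N θ.toStage13Params P k).χ (s₀ P k) V * (reprOfRecord₁₃ F N θ.toStage13Params P k).TexpA (s₀ P k) V) :
    B16.Cor3With (datumOfRecord₁₃CoPH F N θ h).C γ em ep :=
  cor3With_datumOfRecord₁₃CoPH_of_repr218Leaves F N θ h γ em ep major s₀ hS hU1 hU2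
    (fun P _ k _ _ s V => leafL1_at_record₁₃_of_zeta_nonneg F N θ hζ P k s V) hL2

/-- **★★★ K1⁷'s (B) CONJUNCT AT A RECORD CARRYING K0b's RESIDUALS = THEOREM 1 AT THE RECORD + THREE LEAVES (U1, U2, L2)** on some `]0, γ]` (part 1's
`endStatementBPrinted_…_of_thm1_of_repr218Leaves` with (L1) := §1 at `HasResidualsOfRecord`).  CONDITIONAL; nothing of Bałaban's asserted; K1⁷ NOT closed.
[cite: Balaban1989LargeFieldII, Thm 1 p.355, (0.1) pp.355–356, p.391; Balaban1988Convergent, Cor. 3 p.264, (3.16) p.268] -/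
theorem endStatementBPrinted_datumOfRecord₁₃CoPH_of_thm1_of_U1_U2_L2_of_hasResidualsOfRecord (hres : θ.toStage13Params.HasResidualsOfRecord F N)
    (γ : ℝ) (hγ : 0 < γ) (em ep : ℝ → ℝ)
    (major : (P : B12.RunParams) → (k : ℕ) → (reprOfRecord₁₃ F N θ.toStage13Params P k).Adm → ℝ)
    (s₀ : (P : B12.RunParams) → (k : ℕ) → (reprOfRecord₁₃ F N θ.toStage13Params P k).Adm)
    (h1 : B16.Thm1Printed (datumOfRecord₁₃CoPH F N θ h).C)
    (hU1 : ∀ P : B12.RunParams, ((datumOfRecord₁₃CoPH F N θ h).C P).flow.InInterval γ P.K → ∀ k, k ≤ P.K → SLaw₁₃CoPH F N θ P k →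
      ∀ s V, (reprOfRecord₁₃ F N θ.toStage13Params P k).χ s V * (reprOfRecord₁₃ F N θ.toStage13Params P k).TexpA s V ≤ major P k s)
    (hU2 : ∀ P : B12.RunParams, ((datumOfRecord₁₃CoPH F N θ h).C P).flow.InInterval γ P.K → ∀ k, k ≤ P.K → SLaw₁₃CoPH F N θ P k →
      ∑ s, major P k s ≤ Real.exp (ep (gOfRecord₁₃ F N θ.toStage13Params P k) * (Fintype.card (Site (F.P P.K) k) : ℝ)))
    (hL2 : ∀ P : B12.RunParams, ((datumOfRecord₁₃CoPH F N θ h).C P).flow.InInterval γ P.K → ∀ k, k ≤ P.K → SLaw₁₃CoPH F N θ P k →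
      ∀ V, chiβOfRecord₁₃ F N θ.toStage13Params P.K (gOfRecord₁₃ F N θ.toStage13Params P) k V *
          Real.exp (-(1 / (gOfRecord₁₃ F N θ.toStage13Params P k) ^ 2 * wilsonBGOfRecord F N θ.εbg P k V)
            - em (gOfRecord₁₃ F N θ.toStage13Params P k) * (Fintype.card (Site (F.P P.K) k) : ℝ)) ≤
        (reprOfRecord₁₃ F N θ.toStage13Params P k).χ (s₀ P k) V * (reprOfRecord₁₃ F N θ.toStage13Params P k).TexpA (s₀ P k) V) :
    B16.EndStatementBPrinted (datumOfRecord₁₃CoPH F N θ h).C :=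
  endStatementBPrinted_datumOfRecord₁₃CoPH_of_thm1_of_repr218Leaves F N θ h γ hγ em ep major s₀ h1 hU1 hU2
    (fun P _ k _ _ s V => leafL1_at_record₁₃_of_hasResidualsOfRecord F N θ hres P k s V) hL2

variable (w : WorldP)

/-- **★ n24-c's ROW `hUV` FROM THREE LEAVES when `ζ ≥ 0`** (part 1's `hUV₁₃CoPH_of_repr218Leaves` with (L1) := §1). [cite: Balaban1988Convergent, Cor. 3 (2.50) p.264 (bookkeeping)] -/
theorem hUV₁₃CoPH_of_U1_U2_L2_of_zeta_nonneg (hζ : ∀ p g k s Pl Ql RS U V', 0 ≤ θ.ζ p g k s Pl Ql RS U V')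
    (major : (P : B12.RunParams) → (k : ℕ) → (reprOfRecord₁₃ F N θ.toStage13Params P k).Adm → ℝ)
    (s₀ : (P : B12.RunParams) → (k : ℕ) → (reprOfRecord₁₃ F N θ.toStage13Params P k).Adm)
    (hU1 : ∀ P : B12.RunParams, (genFlow (betaOfRecord₁₃ F N θ.toStage13Params) P.g0).InInterval w.γ P.K → ∀ k, k ≤ P.K → SLaw₁₃CoPH F N θ P k →
      ∀ s V, (reprOfRecord₁₃ F N θ.toStage13Params P k).χ s V * (reprOfRecord₁₃ F N θ.toStage13Params P k).TexpA s V ≤ major P k s)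
    (hU2 : ∀ P : B12.RunParams, (genFlow (betaOfRecord₁₃ F N θ.toStage13Params) P.g0).InInterval w.γ P.K → ∀ k, k ≤ P.K → SLaw₁₃CoPH F N θ P k →
      ∑ s, major P k s ≤ Real.exp (w.ep (gOfRecord₁₃ F N θ.toStage13Params P k) * (Fintype.card (Site (F.P P.K) k) : ℝ)))
    (hL2 : ∀ P : B12.RunParams, (genFlow (betaOfRecord₁₃ F N θ.toStage13Params) P.g0).InInterval w.γ P.K → ∀ k, k ≤ P.K → SLaw₁₃CoPH F N θ P k →
      ∀ V, chiβOfRecord₁₃ F N θ.toStage13Params P.K (gOfRecord₁₃ F N θ.toStage13Params P) k V *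
          Real.exp (-(1 / (gOfRecord₁₃ F N θ.toStage13Params P k) ^ 2 * wilsonBGOfRecord F N θ.εbg P k V)
            - w.em (gOfRecord₁₃ F N θ.toStage13Params P k) * (Fintype.card (Site (F.P P.K) k) : ℝ)) ≤
        (reprOfRecord₁₃ F N θ.toStage13Params P k).χ (s₀ P k) V * (reprOfRecord₁₃ F N θ.toStage13Params P k).TexpA (s₀ P k) V) :
    ∀ P : B12.RunParams, (genFlow (betaOfRecord₁₃ F N θ.toStage13Params) P.g0).InInterval w.γ P.K → ∀ k, k ≤ P.K → SLaw₁₃CoPH F N θ P k →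
      ∀ U : GaugeField (F.P P.K) k (SU N),
        chiβOfRecord₁₃ F N θ.toStage13Params P.K (gOfRecord₁₃ F N θ.toStage13Params P) k U *
              Real.exp (-(1 / (gOfRecord₁₃ F N θ.toStage13Params P k) ^ 2 * wilsonBGOfRecord F N θ.εbg P k U)
                - w.em (gOfRecord₁₃ F N θ.toStage13Params P k) * (Fintype.card (Site (F.P P.K) k) : ℝ)) ≤ densOfRecord₁₃ F N θ.toStage13Params P k U ∧
        densOfRecord₁₃ F N θ.toStage13Params P k U ≤ Real.exp (w.ep (gOfRecord₁₃ F N θ.toStage13Params P k) * (Fintype.card (Site (F.P P.K) k) : ℝ)) :=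
  hUV₁₃CoPH_of_repr218Leaves F N θ w major s₀ hU1 hU2 (fun P _ k _ _ s V => leafL1_at_record₁₃_of_zeta_nonneg F N θ hζ P k s V) hL2

end ThreeLeaves

/-! ## §3. AT K1⁷'s OWN PROVISO `h : θ.Provisos₁₃CoPH`: `ζ ≥ 0` is forced (rows `zetaUnity`, `zetaAbs`), so leaf (L1) needs NO extra hypothesis -/

section AtProvisos

variable (θ : Stage13HParams F N)

/-- `0 ≤ ζ` at every parameter with the core provisos (dag-n21-d's `N21StepWeightsPositivity.zetaOfRecord_nonneg` on `h.zetaUnity`, `h.zetaAbs`: `Σ ζ = 1 ∧ Σ |ζ| ≤ 1 ⇒ ζ ≥ 0`; the same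
one-liner as n21-w's `zeta_nonneg_of_provisos₁₃CoPH`, restated here to keep this file's imports light). [cite: Balaban1988Convergent, (3.16) p.268, (3.21) p.269 (bookkeeping)] -/
theorem zeta_nonneg_of_provisos₁₃CoPH' (h : θ.Provisos₁₃CoPH F N) : ∀ p g k s Pl Ql RS U V', 0 ≤ θ.ζ p g k s Pl Ql RS U V' :=
  zetaOfRecord_nonneg F N θ.ν θ.τ9.M h.zetaUnity h.zetaAbs

/-- **★★ LEAF (L1) AT K1⁷'s OWN RECORD, HYPOTHESIS-FREE BEYOND THE PROVISO**: every history term of (2.18) at `reprOfRecord₁₃ θ P k` is `≥ 0`. [cite: Balaban1989LargeFieldII, p.380 (1.73)–(1.75); Balaban1988Convergent, (2.18) p.257 (bookkeeping)] -/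
theorem leafL1_at_record₁₃_of_provisos₁₃CoPH (h : θ.Provisos₁₃CoPH F N) (P : B12.RunParams) (k : ℕ) (s : (reprOfRecord₁₃ F N θ.toStage13Params P k).Adm)
    (V : GaugeField (F.P P.K) k (SU N)) :
    0 ≤ (reprOfRecord₁₃ F N θ.toStage13Params P k).χ s V * (reprOfRecord₁₃ F N θ.toStage13Params P k).TexpA s V :=
  leafL1_at_record₁₃_of_zeta_nonneg F N θ (zeta_nonneg_of_provisos₁₃CoPH' F N θ h) P k s V

/-- `ρ_k ≥ 0` pointwise at every record with the core provisos. [cite: Balaban1989LargeFieldI, p.176; Balaban1988Convergent, (2.18) p.257 (bookkeeping)] -/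
theorem densOfRecord₁₃_nonneg_of_provisos₁₃CoPH (h : θ.Provisos₁₃CoPH F N) (P : B12.RunParams) (k : ℕ) (V : GaugeField (F.P P.K) k (SU N)) :
    0 ≤ densOfRecord₁₃ F N θ.toStage13Params P k V :=
  densOfRecord₁₃_nonneg_of_zeta_nonneg F N θ (zeta_nonneg_of_provisos₁₃CoPH' F N θ h) P k V

/-- **★★★ [III] COR. 3 «WITH e±» AT K1⁷'s OWN RECORD FROM THREE LEAVES (U1, U2, L2)** — leaves (H) and (L1) BOTH discharged. CONDITIONAL on U1∕U2∕L2 and `hS`; nothing of Bałaban's asserted.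
[cite: Balaban1988Convergent, Thm 1 p.262, Cor. 3 (2.50) p.264 (bookkeeping)] -/
theorem cor3With_datumOfRecord₁₃CoPH_of_U1_U2_L2 (h : θ.Provisos₁₃CoPH F N) (γ : ℝ) (em ep : ℝ → ℝ)
    (major : (P : B12.RunParams) → (k : ℕ) → (reprOfRecord₁₃ F N θ.toStage13Params P k).Adm → ℝ)
    (s₀ : (P : B12.RunParams) → (k : ℕ) → (reprOfRecord₁₃ F N θ.toStage13Params P k).Adm)
    (hS : ∀ P : B12.RunParams, ((datumOfRecord₁₃CoPH F N θ h).C P).flow.InInterval γ P.K → ∀ k, k ≤ P.K → SLaw₁₃CoPH F N θ P k)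
    (hU1 : ∀ P : B12.RunParams, ((datumOfRecord₁₃CoPH F N θ h).C P).flow.InInterval γ P.K → ∀ k, k ≤ P.K → SLaw₁₃CoPH F N θ P k →
      ∀ s V, (reprOfRecord₁₃ F N θ.toStage13Params P k).χ s V * (reprOfRecord₁₃ F N θ.toStage13Params P k).TexpA s V ≤ major P k s)
    (hU2 : ∀ P : B12.RunParams, ((datumOfRecord₁₃CoPH F N θ h).C P).flow.InInterval γ P.K → ∀ k, k ≤ P.K → SLaw₁₃CoPH F N θ P k →
      ∑ s, major P k s ≤ Real.exp (ep (gOfRecord₁₃ F N θ.toStage13Params P k) * (Fintype.card (Site (F.P P.K) k) : ℝ)))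
    (hL2 : ∀ P : B12.RunParams, ((datumOfRecord₁₃CoPH F N θ h).C P).flow.InInterval γ P.K → ∀ k, k ≤ P.K → SLaw₁₃CoPH F N θ P k →
      ∀ V, chiβOfRecord₁₃ F N θ.toStage13Params P.K (gOfRecord₁₃ F N θ.toStage13Params P) k V *
          Real.exp (-(1 / (gOfRecord₁₃ F N θ.toStage13Params P k) ^ 2 * wilsonBGOfRecord F N θ.εbg P k V)
            - em (gOfRecord₁₃ F N θ.toStage13Params P k) * (Fintype.card (Site (F.P P.K) k) : ℝ)) ≤
        (reprOfRecord₁₃ F N θ.toStage13Params P k).χ (s₀ P k) V * (reprOfRecord₁₃ F N θ.toStage13Params P k).TexpA (s₀ P k) V) :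
    B16.Cor3With (datumOfRecord₁₃CoPH F N θ h).C γ em ep :=
  cor3With_datumOfRecord₁₃CoPH_of_U1_U2_L2_of_zeta_nonneg F N θ h (zeta_nonneg_of_provisos₁₃CoPH' F N θ h) γ em ep major s₀ hS hU1 hU2 hL2

/-- **★★★ K1⁷'s (B) CONJUNCT AT ITS OWN RECORD = THEOREM 1 AT THE RECORD + THREE LEAVES (U1, U2, L2)** on some `]0, γ]` — adv3's leaves (H) and (L1) BOTH DISCHARGED at NODE 00's record
(`holds_densOfRecord₁₃`; `ζ ≥ 0` from `Provisos₁₃CoPH`).  What the Cor.-3 half of `B16.EndStatementBPrinted (datumOfRecord₁₃CoPH θ h).C` costs, by name: (U1) per-history majorants, (U2) their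
summability `≤ exp(e₊(g_k)|T₁^{(k)}|)`, (L2) the all-small history's lower bound against the core χ — all DISPLAYED.  CONDITIONAL; nothing of Bałaban's asserted; K1⁷ NOT closed.
[cite: Balaban1989LargeFieldII, Thm 1 p.355, (0.1) pp.355–356, p.391; Balaban1988Convergent, Cor. 3 p.264, (3.16) p.268, (3.21) p.269] -/
theorem endStatementBPrinted_datumOfRecord₁₃CoPH_of_thm1_of_U1_U2_L2 (h : θ.Provisos₁₃CoPH F N) (γ : ℝ) (hγ : 0 < γ) (em ep : ℝ → ℝ)
    (major : (P : B12.RunParams) → (k : ℕ) → (reprOfRecord₁₃ F N θ.toStage13Params P k).Adm → ℝ)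
    (s₀ : (P : B12.RunParams) → (k : ℕ) → (reprOfRecord₁₃ F N θ.toStage13Params P k).Adm)
    (h1 : B16.Thm1Printed (datumOfRecord₁₃CoPH F N θ h).C)
    (hU1 : ∀ P : B12.RunParams, ((datumOfRecord₁₃CoPH F N θ h).C P).flow.InInterval γ P.K → ∀ k, k ≤ P.K → SLaw₁₃CoPH F N θ P k →
      ∀ s V, (reprOfRecord₁₃ F N θ.toStage13Params P k).χ s V * (reprOfRecord₁₃ F N θ.toStage13Params P k).TexpA s V ≤ major P k s)
    (hU2 : ∀ P : B12.RunParams, ((datumOfRecord₁₃CoPH F N θ h).C P).flow.InInterval γ P.K → ∀ k, k ≤ P.K → SLaw₁₃CoPH F N θ P k →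
      ∑ s, major P k s ≤ Real.exp (ep (gOfRecord₁₃ F N θ.toStage13Params P k) * (Fintype.card (Site (F.P P.K) k) : ℝ)))
    (hL2 : ∀ P : B12.RunParams, ((datumOfRecord₁₃CoPH F N θ h).C P).flow.InInterval γ P.K → ∀ k, k ≤ P.K → SLaw₁₃CoPH F N θ P k →
      ∀ V, chiβOfRecord₁₃ F N θ.toStage13Params P.K (gOfRecord₁₃ F N θ.toStage13Params P) k V *
          Real.exp (-(1 / (gOfRecord₁₃ F N θ.toStage13Params P k) ^ 2 * wilsonBGOfRecord F N θ.εbg P k V)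
            - em (gOfRecord₁₃ F N θ.toStage13Params P k) * (Fintype.card (Site (F.P P.K) k) : ℝ)) ≤
        (reprOfRecord₁₃ F N θ.toStage13Params P k).χ (s₀ P k) V * (reprOfRecord₁₃ F N θ.toStage13Params P k).TexpA (s₀ P k) V) :
    B16.EndStatementBPrinted (datumOfRecord₁₃CoPH F N θ h).C :=
  endStatementBPrinted_datumOfRecord₁₃CoPH_of_thm1_of_repr218Leaves F N θ h γ hγ em ep major s₀ h1 hU1 hU2
    (fun P _ k _ _ s V => leafL1_at_record₁₃_of_provisos₁₃CoPH F N θ h P k s V) hL2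

variable (w : WorldP)

/-- **★ n24-c's ROW `hUV` FROM THREE LEAVES at every parameter with the core provisos.** [cite: Balaban1988Convergent, Cor. 3 (2.50) p.264 (bookkeeping)] -/
theorem hUV₁₃CoPH_of_U1_U2_L2 (h : θ.Provisos₁₃CoPH F N)
    (major : (P : B12.RunParams) → (k : ℕ) → (reprOfRecord₁₃ F N θ.toStage13Params P k).Adm → ℝ)
    (s₀ : (P : B12.RunParams) → (k : ℕ) → (reprOfRecord₁₃ F N θ.toStage13Params P k).Adm)
    (hU1 : ∀ P : B12.RunParams, (genFlow (betaOfRecord₁₃ F N θ.toStage13Params) P.g0).InInterval w.γ P.K → ∀ k, k ≤ P.K → SLaw₁₃CoPH F N θ P k →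
      ∀ s V, (reprOfRecord₁₃ F N θ.toStage13Params P k).χ s V * (reprOfRecord₁₃ F N θ.toStage13Params P k).TexpA s V ≤ major P k s)
    (hU2 : ∀ P : B12.RunParams, (genFlow (betaOfRecord₁₃ F N θ.toStage13Params) P.g0).InInterval w.γ P.K → ∀ k, k ≤ P.K → SLaw₁₃CoPH F N θ P k →
      ∑ s, major P k s ≤ Real.exp (w.ep (gOfRecord₁₃ F N θ.toStage13Params P k) * (Fintype.card (Site (F.P P.K) k) : ℝ)))
    (hL2 : ∀ P : B12.RunParams, (genFlow (betaOfRecord₁₃ F N θ.toStage13Params) P.g0).InInterval w.γ P.K → ∀ k, k ≤ P.K → SLaw₁₃CoPH F N θ P k →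
      ∀ V, chiβOfRecord₁₃ F N θ.toStage13Params P.K (gOfRecord₁₃ F N θ.toStage13Params P) k V *
          Real.exp (-(1 / (gOfRecord₁₃ F N θ.toStage13Params P k) ^ 2 * wilsonBGOfRecord F N θ.εbg P k V)
            - w.em (gOfRecord₁₃ F N θ.toStage13Params P k) * (Fintype.card (Site (F.P P.K) k) : ℝ)) ≤
        (reprOfRecord₁₃ F N θ.toStage13Params P k).χ (s₀ P k) V * (reprOfRecord₁₃ F N θ.toStage13Params P k).TexpA (s₀ P k) V) :
    ∀ P : B12.RunParams, (genFlow (betaOfRecord₁₃ F N θ.toStage13Params) P.g0).InInterval w.γ P.K → ∀ k, k ≤ P.K → SLaw₁₃CoPH F N θ P k →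
      ∀ U : GaugeField (F.P P.K) k (SU N),
        chiβOfRecord₁₃ F N θ.toStage13Params P.K (gOfRecord₁₃ F N θ.toStage13Params P) k U *
              Real.exp (-(1 / (gOfRecord₁₃ F N θ.toStage13Params P k) ^ 2 * wilsonBGOfRecord F N θ.εbg P k U)
                - w.em (gOfRecord₁₃ F N θ.toStage13Params P k) * (Fintype.card (Site (F.P P.K) k) : ℝ)) ≤ densOfRecord₁₃ F N θ.toStage13Params P k U ∧
        densOfRecord₁₃ F N θ.toStage13Params P k U ≤ Real.exp (w.ep (gOfRecord₁₃ F N θ.toStage13Params P k) * (Fintype.card (Site (F.P P.K) k) : ℝ)) :=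
  hUV₁₃CoPH_of_U1_U2_L2_of_zeta_nonneg F N θ w (zeta_nonneg_of_provisos₁₃CoPH' F N θ h) major s₀ hU1 hU2 hL2

end AtProvisos

end Summit.QuantumFields.YangMills.BalabanUVNodes.N13Cor3LeafL1AtRecord13CoPH

end
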